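import Literature.NumberTheory.LFunctions.PolyBoxCertificate
import HarnessLib

/-!
# Grouped box sign certificates: polynomials that are sparse in the "outer" variables

`PolyBoxCertificate.lean` bounds a monomial list `P(v; x)` over a box termwise. When many
monomials share the same outer factor `Π_k μ_k^{e_k}` and differ only in the power of one
distinguished inner variable `δ` (the situation of the renormalised Jensen polynomials in moment
form, which are LINEAR in the moments `μ` with `δ`-polynomial coefficients), termwise evaluation
loses the dependency between those monomials. Grouping them — bound the inner `δ, x`-polynomial of
each group first, then multiply once by the interval of the outer factor — is still elementary
interval arithmetic [Moore 1979, Thm. 3.1] but much tighter (exact in the outer variables when the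
polynomial is linear in them and `δ` is a point).

* `GPoly = List (List ℕ × List (ℤ × ℕ × ℕ))` — groups `(e, [(c, a, f), …])` meaning
  `(Π_k μ_k^{e_k}) · Σ c δ^a x^f`; `gpolyEvalR G (δ :: μ) x`;
* `gpolyLower/gpolyUpper` over a box `(δ-pair) :: μ-box`, inclusion theorem
  `gpolyLower_le_and_le_gpolyUpper`;
* `GPolyCertifies G B d u` (decidable) and SOUNDNESS `splits_of_gpolyCertifies` — same statement
  shape as `splits_of_polyCertifies` [Szegő §3.3 (5)–(6)].

## References
* [Moore1979] R. E. Moore, *Methods and Applications of Interval Analysis*, SIAM 1979, Ch. 3, Thm. 3.1.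
* [Szego1939] G. Szegő, *Orthogonal Polynomials*, §3.3 (5)–(6).
-/

open Polynomial Finset

namespace Literature.NumberTheory.LFunctions

/-- A grouped polynomial: list of `(outer exponents e, inner terms [(c, a, f)])`, value
`Σ_groups (Π_k μ_k^{e_k}) · Σ_terms c · δ^a · x^f`. [cite: Moore1979, Ch. 3, Thm. 3.1] -/
abbrev GPoly := List (List ℕ × List (ℤ × ℕ × ℕ))

/-- Real value of the inner `δ, x`-polynomial of a group. [folklore] -/
noncomputable def innerEvalR (ts : List (ℤ × ℕ × ℕ)) (δ x : ℝ) : ℝ :=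
  (ts.map fun t => (t.1 : ℝ) * δ ^ t.2.1 * x ^ t.2.2).sum

/-- Real value of a grouped polynomial at `V = δ :: μ` (junk `0`-free: an empty `V` gives `δ = 0`
by `List.headD`). [folklore] -/
noncomputable def gpolyEvalR (G : GPoly) (V : List ℝ) (x : ℝ) : ℝ :=
  (G.map fun g => powProdR V.tail g.1 * innerEvalR g.2 (V.headD 0) x).sum

/-- Interval of the inner polynomial over the `δ`-pair at a rational `x`. [folklore] -/
def innerIval (ts : List (ℤ × ℕ × ℕ)) (dI : ℚ × ℚ) (x : ℚ) : ℚ × ℚ :=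
  ts.foldr (fun t acc =>
    let J := ipMul ((t.1 : ℚ) * x ^ t.2.2, (t.1 : ℚ) * x ^ t.2.2) (ipPow dI t.2.1)
    (J.1 + acc.1, J.2 + acc.2)) (0, 0)

/-- Interval of a grouped polynomial over the box `dI :: B` at a rational `x`. [folklore] -/
def gpolyIval (G : GPoly) (B : List (ℚ × ℚ)) (x : ℚ) : ℚ × ℚ :=
  G.foldr (fun g acc =>
    let J := ipMul (powProdI B.tail g.1) (innerIval g.2 (B.headD (0, 0)) x)
    (J.1 + acc.1, J.2 + acc.2)) (0, 0)

/-- Lower bound of a grouped polynomial over a box. [folklore] -/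
def gpolyLower (G : GPoly) (B : List (ℚ × ℚ)) (x : ℚ) : ℚ := (gpolyIval G B x).1

/-- Upper bound of a grouped polynomial over a box. [folklore] -/
def gpolyUpper (G : GPoly) (B : List (ℚ × ℚ)) (x : ℚ) : ℚ := (gpolyIval G B x).2

/-- Inclusion for the inner polynomial. [cite: Moore1979, Ch. 3, Thm. 3.1] -/
theorem ipMem_innerIval (ts : List (ℤ × ℕ × ℕ)) {dI : ℚ × ℚ} {δ : ℝ} (hδ : IPMem dI δ) (x : ℚ) :
    IPMem (innerIval ts dI x) (innerEvalR ts δ (x : ℝ)) := by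
  induction ts with
  | nil => simp [IPMem, innerIval, innerEvalR]
  | cons t ts ih =>
    have hs : IPMem ((t.1 : ℚ) * x ^ t.2.2, (t.1 : ℚ) * x ^ t.2.2) ((t.1 : ℝ) * (x : ℝ) ^ t.2.2) := by
      constructor <;> push_cast <;> exact le_rfl
    have ht := ipMem_ipMul hs (ipMem_ipPow hδ t.2.1)
    have hval : (t.1 : ℝ) * (x : ℝ) ^ t.2.2 * δ ^ t.2.1 = (t.1 : ℝ) * δ ^ t.2.1 * (x : ℝ) ^ t.2.2 := by
      ring
    rw [hval] at ht
    simp only [innerIval, List.foldr_cons, innerEvalR, List.map_cons, List.sum_cons] at ih ⊢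
    exact ⟨by push_cast; exact add_le_add ht.1 ih.1, by push_cast; exact add_le_add ht.2 ih.2⟩

/-- **Inclusion** for a grouped polynomial: `gpolyLower ≤ G(V; x) ≤ gpolyUpper` for `V` in the box
`B` (first coordinate = `δ`). [cite: Moore1979, Ch. 3, Thm. 3.1] -/
theorem gpolyLower_le_and_le_gpolyUpper (G : GPoly) {B : List (ℚ × ℚ)} {V : List ℝ}
    (h : BoxMem B V) (x : ℚ) :
    ((gpolyLower G B x : ℚ) : ℝ) ≤ gpolyEvalR G V (x : ℝ) ∧
      gpolyEvalR G V (x : ℝ) ≤ ((gpolyUpper G B x : ℚ) : ℝ) := by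
  -- split the box membership into head and tail
  have hhead : IPMem (B.headD (0, 0)) (V.headD 0) := by
    cases h with
    | nil => simp [IPMem]
    | cons hb _ => exact hb
  have htail : BoxMem B.tail V.tail := by
    cases h with
    | nil => exact List.Forall₂.nil
    | cons _ ht => exact ht
  unfold gpolyLower gpolyUpper
  induction G with
  | nil => simp [gpolyIval, gpolyEvalR]
  | cons g G ih =>
    have hg := ipMem_ipMul (ipMem_powProd htail g.1) (ipMem_innerIval g.2 hhead x)
    simp only [gpolyIval, List.foldr_cons, gpolyEvalR, List.map_cons, List.sum_cons] at ih ⊢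
    exact ⟨by push_cast; exact add_le_add hg.1 ih.1, by push_cast; exact add_le_add hg.2 ih.2⟩

/-- Certified sign of a grouped polynomial over the box. [folklore] -/
def gpolySignAt (G : GPoly) (B : List (ℚ × ℚ)) (x : ℚ) : ℤ :=
  if 0 < gpolyLower G B x then 1 else if gpolyUpper G B x < 0 then -1 else 0

/-- **Grouped box sign certificate** (decidable). [cite: Szego1939, §3.3 (5)–(6)] -/
def GPolyCertifies (G : GPoly) (B : List (ℚ × ℚ)) (d : ℕ) (u : Fin (d + 1) → ℚ) : Prop :=
  (∀ i : Fin d, u i.castSucc < u i.succ) ∧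
    ∀ i : Fin d, gpolySignAt G B (u i.castSucc) * gpolySignAt G B (u i.succ) = -1

/-- `GPolyCertifies` is decidable. [folklore] -/
instance (G : GPoly) (B : List (ℚ × ℚ)) (d : ℕ) (u : Fin (d + 1) → ℚ) :
    Decidable (GPolyCertifies G B d u) := by
  unfold GPolyCertifies; infer_instance

section Soundness

variable {G : GPoly} {B : List (ℚ × ℚ)} {V : List ℝ} {Q : ℝ[X]} {c : ℝ}

/-- Opposite certified signs give a sign change. [folklore] -/
private theorem eval_mul_eval_neg_of_gpolySignAt (h : BoxMem B V) (hc : 0 < c)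
    (hQ : ∀ x : ℚ, c * Q.eval (x : ℝ) = gpolyEvalR G V x) {x y : ℚ}
    (hs : gpolySignAt G B x * gpolySignAt G B y = -1) :
    Q.eval (x : ℝ) * Q.eval (y : ℝ) < 0 := by
  have pos : ∀ {z : ℚ}, gpolySignAt G B z = 1 → 0 < Q.eval (z : ℝ) := by
    intro z hz
    have h1 : 0 < gpolyLower G B z := by
      by_contra hc'
      unfold gpolySignAt at hz
      rw [if_neg hc'] at hz
      by_cases h2 : gpolyUpper G B z < 0
      · rw [if_pos h2] at hz; omega
      · rw [if_neg h2] at hz; omega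
    have := (gpolyLower_le_and_le_gpolyUpper G h z).1
    have hcz : 0 < c * Q.eval (z : ℝ) := by
      rw [hQ]; exact lt_of_lt_of_le (by exact_mod_cast h1) this
    exact pos_of_mul_pos_right hcz hc.le
  have neg : ∀ {z : ℚ}, gpolySignAt G B z = -1 → Q.eval (z : ℝ) < 0 := by
    intro z hz
    have h2 : gpolyUpper G B z < 0 := by
      by_contra hc'
      unfold gpolySignAt at hz
      by_cases h1 : 0 < gpolyLower G B z
      · rw [if_pos h1] at hz; omega
      · rw [if_neg h1, if_neg hc'] at hz; omega
    have := (gpolyLower_le_and_le_gpolyUpper G h z).2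
    have hcz : c * Q.eval (z : ℝ) < 0 := by
      rw [hQ]; exact lt_of_le_of_lt this (by exact_mod_cast h2)
    exact neg_of_mul_neg_right hcz hc.le
  have hx : gpolySignAt G B x = 1 ∨ gpolySignAt G B x = -1 ∨ gpolySignAt G B x = 0 := by
    unfold gpolySignAt; split_ifs <;> simp
  have hy : gpolySignAt G B y = 1 ∨ gpolySignAt G B y = -1 ∨ gpolySignAt G B y = 0 := by
    unfold gpolySignAt; split_ifs <;> simp
  rcases hx with hx | hx | hx <;> rcases hy with hy | hy | hy <;> rw [hx, hy] at hs <;> norm_num at hs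
  · exact mul_neg_of_pos_of_neg (pos hx) (neg hy)
  · exact mul_neg_of_neg_of_pos (neg hx) (pos hy)

/-- **Soundness of the grouped box sign certificate.** [cite: Szego1939, §3.3 (5)–(6)] -/
theorem splits_of_gpolyCertifies {d : ℕ} {u : Fin (d + 1) → ℚ} (hcert : GPolyCertifies G B d u)
    (h : BoxMem B V) (hc : 0 < c) (hdeg : Q.natDegree ≤ d)
    (hQ : ∀ x : ℚ, c * Q.eval (x : ℝ) = gpolyEvalR G V x) : Q.Splits := by
  obtain ⟨hmono, halt⟩ := hcert
  rcases Nat.eq_zero_or_pos d with rfl | hd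
  · rw [eq_C_of_natDegree_le_zero hdeg]; exact Splits.C _
  · have hu : StrictMono (fun i : Fin (d + 1) => ((u i : ℚ) : ℝ)) :=
      Fin.strictMono_iff_lt_succ.2 fun i => by exact_mod_cast hmono i
    have halt' : ∀ i : Fin d,
        Q.eval (((u i.castSucc : ℚ)) : ℝ) * Q.eval (((u i.succ : ℚ)) : ℝ) < 0 :=
      fun i => eval_mul_eval_neg_of_gpolySignAt h hc hQ (halt i)
    obtain ⟨t, ht, -, hroot⟩ :=
      exists_roots_of_alternating Q (fun i : Fin (d + 1) => ((u i : ℚ) : ℝ)) hu halt'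
    have hQ0 : Q ≠ 0 := by
      intro h0
      have := halt' ⟨0, hd⟩
      rw [h0] at this
      simp at this
    exact (splits_of_roots hQ0 hdeg t ht.injective hroot).1

end Soundness

end Literature.NumberTheory.LFunctions
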